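import Literature.InformationTheory.QuantumCodes.SyndromeDecodingAdditive
import HarnessLib

/-!
# The optimal correction radius of an additive (stabilizer) code presented by generators, `⌊(d − 1)/2⌋`, as a predicate

Topic `InformationTheory/QuantumCodes`; namespace `Literature.InformationTheory.QuantumCodes.AdditiveCode`.
Companion of `OptimalRadius.lean` (the CSS / sector-wise picture) for GENERAL additive codes `S̄ ≤ Ē = 𝔽₂ⁿ × 𝔽₂ⁿ` in the
symplectic picture of Calderbank–Rains–Shor–Sloane and Gottesman: the code is presented by a generator family
`g : ι → SympVec n` (`S̄ = span g`), the syndrome of a Pauli error `e` is the vector of symplectic inner products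
`(⟨g i, e⟩)_i` (`sympSyndrome g`, Gottesman's `f(E)`), success = the net operation lies in `S̄` (degenerate corrections
count). `SyndromeDecodingAdditive.lean` proves that minimum-weight syndrome decoding has correction radius EXACTLY
`⌊(minDistance S̄ − 1)/2⌋` (`isCorrectionRadius_minWeight_sympSyndrome`; CRSS Thm. 1 "can correct [(d−1)/2] errors") and
that NO decoder corrects more (`le_half_minDistance_of_correctsUpTo`; Gottesman §2.3 "to correct t errors … distance at least
2t+1"). This file NAMES that conclusion, `AdditiveCode.HasOptimalRadius g t`, so that a census row of the additive
(non-CSS) calibration lane states it in one line from its kernel theorem `minDistance (span g) = d`.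

Statements (all PROVED; elementary consequences of the imported file):
* `HasOptimalRadius` (definition), `hasOptimalRadius_iff` (unfolding), `HasOptimalRadius.unique`;
* `hasOptimalRadius_of_pos` — with a logical operator (`0 < minDistance (span g)`) the optimal radius is
  `⌊(minDistance − 1)/2⌋`; `hasOptimalRadius_iff_eq` — and only that number;
* `hasOptimalRadius_of_minDistance_eq` — numeral form from a census theorem `minDistance (span g) = d`, `0 < d`,
  side condition `(d − 1)/2 = t`;
* `hasOptimalRadius_of_span_eq` — the same for a code `S̄` given with a proof `span g = S̄`.

HONEST FRAMING: no code parameter is asserted here; nothing probabilistic. The decoder attaining the radius is minimum-weight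
syndrome decoding as a specified (noncomputable) function; explicit decoder TABLES with a kernel-checked radius are a different
lane. `k = 0` codes (no logical operator, `minDistance = 0` junk value) have no optimal radius in this sense and are excluded by
the positivity hypothesis.

## References
* [CalderbankEtAl1998] Calderbank–Rains–Shor–Sloane, IEEE Trans. IT 44 (1998) 1369, §2 Thm. 1 (printed p. 4: "can correct
  [(d−1)/2] errors").
* [Gottesman1997] D. Gottesman, PhD thesis, arXiv:quant-ph/9705052, §2.3 (chunk p0014 L3), §3.2 (chunk p0018 L105–115: the
  error syndrome).
-/

namespace Literature.InformationTheory.QuantumCodes.AdditiveCode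

variable {n : ℕ} {ι : Type*}

/-- **`t` is the optimal correction radius of the additive code generated by `g`, and it is attained** (Pauli errors
`e ∈ 𝔽₂ⁿ × 𝔽₂ⁿ` weighed by symplectic weight; syndrome `f(e) = (⟨g i, e⟩)_i`; success = net operation in `S̄ = span g`):
SOME decoder — a function from syndromes to corrections — has correction radius exactly `t` (`Decoder.IsCorrectionRadius`:
every error of weight `≤ t` corrected, not every error of weight `≤ t + 1`), and NO decoder corrects every error of weight
`≤ t'` for a `t' > t` ("there is a quantum-error-correcting code … which can correct [(d−1)/2] errors"; "to correct up to t
errors [a code] must have distance at least 2t+1"). (definition)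
[cite: CalderbankEtAl1998, §2 Thm. 1 (printed p. 4)] -/
def HasOptimalRadius (g : ι → SympVec n) (t : ℕ) : Prop :=
  (∃ D : Decoder (ι → ZMod 2) (SympVec n),
      D.IsCorrectionRadius (sympSyndrome g)
        ((Submodule.span (ZMod 2) (Set.range g) : Submodule (ZMod 2) (SympVec n)) : Set (SympVec n)) sympWeight t) ∧
    ∀ (D : Decoder (ι → ZMod 2) (SympVec n)) (t' : ℕ),
      D.CorrectsUpTo (sympSyndrome g)
          ((Submodule.span (ZMod 2) (Set.range g) : Submodule (ZMod 2) (SympVec n)) : Set (SympVec n)) sympWeight t' →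
        t' ≤ t

/-- Unfolding `HasOptimalRadius`: attained by some syndrome decoder (radius exactly `t`) and unbeatable by every decoder.
[cite: CalderbankEtAl1998, §2 Thm. 1 (printed p. 4)] -/
theorem hasOptimalRadius_iff (g : ι → SympVec n) (t : ℕ) :
    HasOptimalRadius g t ↔
      (∃ D : Decoder (ι → ZMod 2) (SympVec n),
          D.IsCorrectionRadius (sympSyndrome g)
            ((Submodule.span (ZMod 2) (Set.range g) : Submodule (ZMod 2) (SympVec n)) : Set (SympVec n)) sympWeight t) ∧
        ∀ (D : Decoder (ι → ZMod 2) (SympVec n)) (t' : ℕ),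
          D.CorrectsUpTo (sympSyndrome g)
              ((Submodule.span (ZMod 2) (Set.range g) : Submodule (ZMod 2) (SympVec n)) : Set (SympVec n)) sympWeight t' →
            t' ≤ t :=
  Iff.rfl

/-- The optimal correction radius is unique. [cite: Gottesman1997, §2.3 (chunk p0014 L3)] -/
theorem HasOptimalRadius.unique {g : ι → SympVec n} {t t' : ℕ} (h : HasOptimalRadius g t)
    (h' : HasOptimalRadius g t') : t = t' := by
  obtain ⟨⟨D, hD⟩, hmax⟩ := h
  obtain ⟨⟨D', hD'⟩, hmax'⟩ := h'
  exact le_antisymm (hmax' D t hD.1) (hmax D' t' hD'.1)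

/-- **The optimal radius is `⌊(d − 1)/2⌋`, `d = minDistance (span g)`**, for a code with a logical operator (`0 < d`):
attained by minimum-weight syndrome decoding (`isCorrectionRadius_minWeight_sympSyndrome`), unbeatable
(`le_half_minDistance_of_correctsUpTo`). (proved)
[cite: CalderbankEtAl1998, §2 Thm. 1 (printed p. 4)] [cite: Gottesman1997, §2.3 (chunk p0014 L3)] -/
theorem hasOptimalRadius_of_pos (g : ι → SympVec n) (hpos : 0 < minDistance (Submodule.span (ZMod 2) (Set.range g))) :
    HasOptimalRadius g ((minDistance (Submodule.span (ZMod 2) (Set.range g)) - 1) / 2) :=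
  ⟨⟨_, isCorrectionRadius_minWeight_sympSyndrome rfl hpos⟩, fun _ _ hD => le_half_minDistance_of_correctsUpTo rfl hpos hD⟩

/-- … and ONLY that number: `HasOptimalRadius g t ↔ t = ⌊(minDistance (span g) − 1)/2⌋` (with a logical operator). (proved)
[cite: Gottesman1997, §2.3 (chunk p0014 L3)] -/
theorem hasOptimalRadius_iff_eq (g : ι → SympVec n) (hpos : 0 < minDistance (Submodule.span (ZMod 2) (Set.range g)))
    {t : ℕ} : HasOptimalRadius g t ↔ t = (minDistance (Submodule.span (ZMod 2) (Set.range g)) - 1) / 2 :=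
  ⟨fun h => h.unique (hasOptimalRadius_of_pos g hpos), fun h => h ▸ hasOptimalRadius_of_pos g hpos⟩

/-- **Numeral form from a census theorem**: if `minDistance (span g) = d` with `0 < d` and `(d − 1)/2 = t`, the code
generated by `g` has optimal correction radius `t`. (proved) [cite: CalderbankEtAl1998, §2 Thm. 1 (printed p. 4: "can correct [(d−1)/2] errors")] -/
theorem hasOptimalRadius_of_minDistance_eq {g : ι → SympVec n} {d t : ℕ}
    (hd : minDistance (Submodule.span (ZMod 2) (Set.range g)) = d) (hpos : 0 < d) (ht : (d - 1) / 2 = t) :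
    HasOptimalRadius g t := by
  subst ht
  rw [← hd]
  exact hasOptimalRadius_of_pos g (hd ▸ hpos)

/-- The same for a code `S̄` presented with a proof `span g = S̄` and a census theorem `minDistance S̄ = d`. (proved)
[cite: CalderbankEtAl1998, §2 Thm. 1 (printed p. 4)] -/
theorem hasOptimalRadius_of_span_eq {g : ι → SympVec n} {S : Submodule (ZMod 2) (SympVec n)}
    (hg : Submodule.span (ZMod 2) (Set.range g) = S) {d t : ℕ} (hd : minDistance S = d) (hpos : 0 < d)
    (ht : (d - 1) / 2 = t) : HasOptimalRadius g t :=
  hasOptimalRadius_of_minDistance_eq (hg ▸ hd) hpos ht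

end Literature.InformationTheory.QuantumCodes.AdditiveCode
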